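import Summits.CriticalPhenomena.PercolationContinuityZ3.Theorems.Transplant.SkelFrm1ClosureLT
import Summits.CriticalPhenomena.PercolationContinuityZ3.Theorems.Transplant.SkelFrm1ChoiceL
import HarnessLib

/-!
# N2 (the frames-only node `SamePDropOfSkeletonFrm₁`, OPEN), (c2) J10 REPAIR ((R-32), design owner p3-g16): THE CHOICE-LEVEL CLOSURE OF RECORD WITH THE FACE INNER-CHAIN
# FACT'S TARGET ACCURACY AS A PARAMETER — `ChainFactQT`, `FaceHoldsRNQFnLT`, `samePDropOfSkeletonFrm₁_of_choiceFnNQLT`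

Successor of `SkelFrm1ChoiceL` (p346376, valid and untouched: the square instance) per J10 (hp-8 g40 01:25:56Z; p5-g15 sieve PASS) and ruling (R-32): the face
inner-chain fact handed down by the closure concludes at a PARAMETRIC target accuracy `δT` — `ChainFactQT Lf G Δ κ δT` (body of `ChainFactQ` verbatim, conclusion
`1 - δT < …`); the (F) obligation of a choice function given flatness and that fact is `FaceHoldsRNQFnLT Lf dT 𝒞₀` (the fact at `δT := dT κ.δ₂`); the top theorem
`samePDropOfSkeletonFrm₁_of_choiceFnNQLT Lf dT hdT 𝒞₀ hGeom hRoot hFace hReach : SamePDropOfSkeletonFrm₁` is over `samePDropOfSkeletonFrm₁_of_residuesNQLT`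
(SkelFrm1ClosureLT).  THE FOUR PROPS THE WRAPPERS TARGET: `GeomHoldsNQFn 𝒞₀` (stmt-g20), `RootHoldsNQWFnL Lf 𝒞₀` (p3), **`FaceHoldsRNQFnLT Lf (fun x => x ^ 3) 𝒞₀`**
(hp-8 g40; `hdT := fun x hx => pow_pos hx 3` in the node file), `ReachHoldsRHNQFnL Lf 𝒞₀` (p5) — Geom/(R)/(C) unchanged by name.  The bridge
`chainFactQ_iff_chainFactQT_sq` records that the landed `ChainFactQ` is the `δT = κ.δ₂ ^ 2` instance.  DEFINITIONS + CONDITIONAL assembly; the node stays OPEN.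
builds on p205010 (kernel theorem, internal audit signed; external expert review pending) through the closure's `chain_edge_from_source_F_KN` ← `AdditiveGluing_proof`.
Lane `prim-bschramm`, seat `prim-bschramm-p3` (gen 16; N2 design owner); helper file (`--supports stmt-CriticalPhenomena-4575 --as helper`).
[cite: KozmaNitzan2024, §4 Theorem 6 (pp. 25–31): the order of constants; §1 p. 2 (approach 1)] [cite: MartineauTassion2017, §3.2 Lemma 3.5]
-/

noncomputable section

open MeasureTheory ProbabilityTheory
open scoped ENNReal Classical

namespace Summit.CriticalPhenomena.PercolationContinuityZ3.Theorems.Transplant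

open Literature.Probability.Percolation Literature.Probability.LatticeModels SimpleGraph KNCells KNLevels
open Literature.Barriers.CriticalPhenomena (HasExponentialGrowth)
open SkelConc (Consts)

namespace PlanarSkeletonFrm

/-- **The FACE INNER-CHAIN FACT handed down by the closure, (S0) kits, TARGET ACCURACY `δT`** (J10/(R-32)): in every window graph, linked chains of
`n + 1 ≤ Lf κ.K₀ + 1` target steps with `KitsAtF` at the flat root accuracy `κ.δr 0`, excess `≤ κ.δr 0 / 2` and source `1 − κ.δr 0` conclude at `1 − δT` —
`ChainFactQ`'s body verbatim with the conclusion's accuracy a parameter. [this work] -/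
def ChainFactQT (Lf : ℕ → ℕ) {V : Type} [DecidableEq V] [Countable V] (G : SimpleGraph V) [G.LocallyFinite] (Δ : ℕ) (κ : Consts) (δT : ℝ) : Prop :=
  ∀ n, n ≤ Lf κ.K₀ → ∀ (q' : unitInterval), (q' : ℝ) < 1 →
    ∀ (c : V) (Rπ : ℕ) (Wg : Sym2 V → unitInterval) (s : Fin (n + 1) → KNLevels.TStep (Skel.winGraph G c Rπ))
      (T' : Fin (n + 1) → Finset V) (η : ℝ),
      (∀ i : Fin (n + 1), (s i).L.o = (s 0).L.o) →
      (∀ i : Fin n, T' (Fin.castSucc i) ⊆ (s i.succ).L.X 0) →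
      (∀ i : Fin (n + 1), T' i ⊆ (s i).T) →
      (∀ i : Fin (n + 1), (s i).KitsAtF Wg q' Δ (κ.δr 0)) →
      η ≤ κ.δr 0 / 2 →
      (∀ i : Fin (n + 1), (prodBernoulli Wg).real (⋃ t ∈ (s i).T \ T' i, openConn (s 0).L.o t) ≤ η) →
      1 - κ.δr 0 < (prodBernoulli Wg).real (s 0).L.reachB →
        1 - δT < (prodBernoulli Wg).real (⋃ t ∈ T' (Fin.last n), openConn (s 0).L.o t)

/-- The landed `ChainFactQ` (SkelFrm1ChoiceDefs p340645) IS the square instance `δT = κ.δ₂ ^ 2` of `ChainFactQT` (by `Iff.rfl`). [folklore] -/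
theorem chainFactQ_iff_chainFactQT_sq (Lf : ℕ → ℕ) {V : Type} [DecidableEq V] [Countable V] (G : SimpleGraph V) [G.LocallyFinite] (Δ : ℕ) (κ : Consts) :
    ChainFactQ Lf G Δ κ ↔ ChainFactQT Lf G Δ κ (κ.δ₂ ^ 2) := Iff.rfl

/-- **The face obligation of an N2 choice function GIVEN the flat root table and the face inner-chain fact at target accuracy `dT κ.δ₂`** (J10/(R-32); the (F)
wrapper takes `dT := fun x => x ^ 3`). [this work] -/
def FaceHoldsRNQFnLT (Lf : ℕ → ℕ) (dT : ℝ → ℝ) (𝒞₀ : ChoiceFnNQ) : Prop :=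
  ∀ (κ : Consts) {V : Type} [DecidableEq V] [Countable V] (G : SimpleGraph V) [G.LocallyFinite] (Φ : PlanarSkeletonFrm G)
    (hg : ¬ HasExponentialGrowth G) (t : V) (ht : t ∈ Φ.types) (h1 : Φ.types = {t}) (p : unitInterval) (hp0 : 0 < (p : ℝ)) (hp1 : (p : ℝ) < 1)
    (hC : Φ.CylSubcritical p), FlatQ Lf κ → ChainFactQT Lf G Φ.Δ κ (dT κ.δ₂) → (𝒞₀ κ G Φ hg t ht h1 p hp0 hp1 hC).FaceHoldsRNQ

/-- **THE N2 PARTIAL CLOSURE OF RECORD, shared-choice form, face target accuracy `dT`** (J10/(R-32); twin of `samePDropOfSkeletonFrm₁_of_choiceFnNQL` over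
`samePDropOfSkeletonFrm₁_of_residuesNQLT`): an N2 choice function meeting the geometric obligation, the forward law-carrying root obligation given flatness, the face
obligation given flatness and the inner-chain fact at `dT κ.δ₂` (`0 < dT x` for `0 < x`), and the budgeted corridor obligation gives `SamePDropOfSkeletonFrm₁`.
[cite: KozmaNitzan2024, §4 Theorem 6 (pp. 25–31); §1 p. 2] -/
theorem samePDropOfSkeletonFrm₁_of_choiceFnNQLT (Lf : ℕ → ℕ) (dT : ℝ → ℝ) (hdT : ∀ x : ℝ, 0 < x → 0 < dT x)
    (𝒞₀ : ChoiceFnNQ) (hGm : GeomHoldsNQFn 𝒞₀) (hR : RootHoldsNQWFnL Lf 𝒞₀)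
    (hF : FaceHoldsRNQFnLT Lf dT 𝒞₀) (hRe : ReachHoldsRHNQFnL Lf 𝒞₀) : SamePDropOfSkeletonFrm₁ := by
  refine samePDropOfSkeletonFrm₁_of_residuesNQLT Lf dT hdT
    fun K₀ δ δ₂ δr hδ0 hδ1 hδ₂0 hδ₂1 hδr hflat {V} _ _ G _ Φ hg t ht h1 p hp0 hp1 _ hC _ hCF => ?_
  set κ : Consts := ⟨K₀, δ, δ₂, δr, hδ0, hδ1, hδ₂0, hδ₂1, hδr⟩ with hκ
  have hflat' : FlatQ Lf κ := hflat
  have hCF' : ChainFactQT Lf G Φ.Δ κ (dT κ.δ₂) := hCF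
  set 𝒞 := 𝒞₀ κ G Φ hg t ht h1 p hp0 hp1 hC with h𝒞
  refine ⟨𝒞.δI, 𝒞.m₀, 𝒞.δI_pos, 𝒞.δI_lt_one, fun O hfacts => ?_⟩
  obtain ⟨hSz, hSMn⟩ := 𝒞.S_adm O hfacts
  refine ⟨𝒞.Sz O, 𝒞.SMn O, hSz, hSMn, fun q hq1 hq2 hin hCq => ?_⟩
  have hat : 𝒞.AtQNQ O q := ⟨hfacts, hq1, hq2, hin, hCq⟩
  obtain ⟨hroot, hK, hrun, hanch, hsep, hexit, hsteps, hlev⟩ := hGm κ G Φ hg t ht h1 p hp0 hp1 hC O q hat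
  obtain ⟨nmax, hnmax, hreach⟩ := hRe κ G Φ hg t ht h1 p hp0 hp1 hC O q hat
  exact ⟨𝒞.Γ O q, 𝒞.FD O q, 𝒞.LD O q, hroot, hK, hrun, hanch, hsep, hexit, hsteps, hlev,
    hR κ G Φ hg t ht h1 p hp0 hp1 hC hflat' O q hat, hF κ G Φ hg t ht h1 p hp0 hp1 hC hflat' hCF' O q hat, nmax, hnmax, hreach⟩

end PlanarSkeletonFrm

end Summit.CriticalPhenomena.PercolationContinuityZ3.Theorems.Transplant

end
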